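import Summits.QuantumFields.YangMills.Theses.CovariantCurrentDoor
import Summits.QuantumFields.YangMills.Theorems.FemtoTransferGapBounds
import HarnessLib

/-!
# `CovariantCurrentDoor.Assembly` (item stmt-QuantumFields-23383) — PROVED:
# (∃-window current bound) → CurrentStatePhysical → FirstLevelPolyTail → ThermalTraceWindow.SubFemtoFirstLevel

Route `CovariantCurrentDoor` (D-0145 LINE g17-B of seat ym-idea-4; draft-by-design onto the leaf K2a).  Given `A > 0`: take the window
`(a, β₁, L₁)`; on `L ≤ β^a` instantiate the exact `l2`-normalised physical vacuum `Ω` (`PhysL2.exists_groundState`); the current state `ψ = XΩ` is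
physical and `⊥ Ω` (`CurrentStatePhysical`), so the tree's domination `Deficit.l2_iterate_le_of_orth_ground` (`m = 1`) gives `⟨ψ, K_βψ⟩ ≤ λ₁‖ψ‖²`;
with `2L·(λ₀‖ψ‖² − ⟨ψ,K_βψ⟩) ≤ λ₀‖ψ‖²` and `‖ψ‖² > 0`: `λ₁ ≥ λ₀(1 − 1/(2L))`, Bernoulli `(1 − 1/(2L))^L ≥ 1/2 ≥ β^{−1}` (`β ≥ 2`)
(`current_endgame`); the tail `β^a ≤ L ≤ β^A` is `FirstLevelPolyTail` at `(a, A)`; exponent `max k₃ 1`.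

HONEST FRAMING: bookkeeping; the cruxes `CurrentCommutatorCeiling`, `CurrentNormFloor`, the support `CurrentStatePhysical` and the tail are
OPEN; K2a, R2ξ″ and the YM mass gap are NOT proved.  No `sorry`, no new axiom, no new definition.
References: [cite: ReedSimonIV1978, Thm. XIII.1]; [cite: Luscher1983, §3].
-/

set_option autoImplicit false

noncomputable section

open MeasureTheory Filter Topology Real
open Literature.MathematicalPhysics.QuantumFieldTheory (GaugeConfig Site gaugeTransform)

namespace Summit.QuantumFields.YangMills.Theorems.CovariantCurrentDoor

open Summit.QuantumFields.YangMills.Theorems.FemtoTransferGap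

/-! ## §1 The endgame -/

/-- **Current endgame** (pure real arithmetic): `Q ≤ S·N` (domination of `ψ ⊥ Ω`), `2L(T·N − Q) ≤ T·N` (door), `N > 0`, `T > 0`, `L ≥ 1`,
`β ≥ 2` ⇒ `β^{−1} T^L ≤ S^L`. [cite: ReedSimonIV1978, Thm. XIII.1] -/
theorem current_endgame {T S N Q β : ℝ} {L : ℕ} (hL : 1 ≤ L) (hT : 0 < T) (hN : 0 < N) (hβ : 2 ≤ β)
    (hdom : Q ≤ S * N) (hwin : 2 * (L : ℝ) * (T * N - Q) ≤ T * N) :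
    β ^ (-(1 : ℝ)) * T ^ L ≤ S ^ L := by
  have hL1 : (1 : ℝ) ≤ L := by exact_mod_cast hL
  have hLpos : (0 : ℝ) < L := by linarith
  have hβpos : 0 < β := by linarith
  -- `T (1 − 1/(2L)) ≤ S`
  have hS : T * (1 - 1 / (2 * (L : ℝ))) ≤ S := by
    have h1 : T * N - Q ≤ T * N / (2 * L) := by
      rw [le_div_iff₀ (by positivity)]; linarith
    have h2 : T * (1 - 1 / (2 * (L : ℝ))) * N ≤ S * N := by
      have : T * (1 - 1 / (2 * (L : ℝ))) * N = T * N - T * N / (2 * L) := by field_simp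
      rw [this]; linarith
    exact le_of_mul_le_mul_right h2 hN
  have hq0 : 0 ≤ 1 - 1 / (2 * (L : ℝ)) := by
    have : 1 / (2 * (L : ℝ)) ≤ 1 / 2 := by
      apply div_le_div_of_nonneg_left (by norm_num) (by norm_num); linarith
    linarith
  have hTS0 : 0 ≤ T * (1 - 1 / (2 * (L : ℝ))) := mul_nonneg hT.le hq0
  have hSL : (T * (1 - 1 / (2 * (L : ℝ)))) ^ L ≤ S ^ L := pow_le_pow_left₀ hTS0 hS L
  -- Bernoulli `(1 − 1/(2L))^L ≥ 1/2`
  have hBern : (1 : ℝ) / 2 ≤ (1 - 1 / (2 * (L : ℝ))) ^ L := by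
    have h : (-2 : ℝ) ≤ -(1 / (2 * (L : ℝ))) := by
      have : 1 / (2 * (L : ℝ)) ≤ 1 / 2 := by
        apply div_le_div_of_nonneg_left (by norm_num) (by norm_num); linarith
      linarith
    have hb := one_add_mul_le_pow h L
    have h12 : 1 + (L : ℝ) * -(1 / (2 * (L : ℝ))) = 1 / 2 := by field_simp; ring
    rw [h12] at hb
    have h1 : (1 : ℝ) + -(1 / (2 * (L : ℝ))) = 1 - 1 / (2 * (L : ℝ)) := by ring
    rw [h1] at hb
    exact hb
  have hB : (1 : ℝ) / 2 * T ^ L ≤ (T * (1 - 1 / (2 * (L : ℝ)))) ^ L := by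
    rw [mul_pow, mul_comm]
    exact mul_le_mul_of_nonneg_left hBern (pow_nonneg hT.le L)
  have hβinv : β ^ (-(1 : ℝ)) ≤ 1 / 2 := by
    rw [Real.rpow_neg_one, inv_le_comm₀ hβpos (by norm_num)]
    linarith
  calc β ^ (-(1 : ℝ)) * T ^ L ≤ 1 / 2 * T ^ L := mul_le_mul_of_nonneg_right hβinv (pow_nonneg hT.le L)
    _ ≤ (T * (1 - 1 / (2 * (L : ℝ)))) ^ L := hB
    _ ≤ S ^ L := hSL

/-! ## §2 The Assembly -/

/-- ★ **Assembly of route `CovariantCurrentDoor`** (item stmt-QuantumFields-23383): window current bound + physical orthogonal current state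
+ polynomial tail ⇒ K2a. [cite: ReedSimonIV1978, Thm. XIII.1] [cite: Luscher1983, §3] -/
theorem assembly_proof : Summit.QuantumFields.YangMills.Theses.CovariantCurrentDoor.Assembly := by
  intro hWin hP hTail A hA
  obtain ⟨a, ha, β₁, L₁, hW⟩ := hWin
  obtain ⟨k₃, β₃, L₃, hT⟩ := hTail a ha A hA
  refine ⟨max k₃ 1, max β₁ (max β₃ 2), max L₁ L₃, ?_⟩
  intro β hβ L _ hL hLA
  have hβ₁ : β₁ ≤ β := le_trans (le_max_left _ _) hβ
  have hβ₃ : β₃ ≤ β := le_trans (le_trans (le_max_left _ _) (le_max_right _ _)) hβ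
  have hβ2 : (2 : ℝ) ≤ β := le_trans (le_trans (le_max_right _ _) (le_max_right _ _)) hβ
  have hβ1 : (1 : ℝ) ≤ β := by linarith
  have hβpos : 0 < β := by linarith
  have hL₁ : L₁ ≤ L := le_trans (le_max_left _ _) hL
  have hL₃ : L₃ ≤ L := le_trans (le_max_right _ _) hL
  have hLone : 1 ≤ L := NeZero.one_le
  have hk1 : β ^ (-(max k₃ 1)) ≤ β ^ (-(1 : ℝ)) := Real.rpow_le_rpow_of_exponent_le hβ1 (neg_le_neg (le_max_right _ _))
  have hk3 : β ^ (-(max k₃ 1)) ≤ β ^ (-k₃) := Real.rpow_le_rpow_of_exponent_le hβ1 (neg_le_neg (le_max_left _ _))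
  have hT0 : 0 < topValue su2Rep L β := topValue_su2Rep_pos L β
  have hpow0 : 0 ≤ levelValue su2Rep L β 0 ^ L := by
    rw [levelValue_zero]; exact pow_nonneg hT0.le L
  by_cases hcase : (L : ℝ) ≤ β ^ a
  · -- ### the window
    obtain ⟨Ω, θ, c, hΩ, -, -, hn, heig, -, -, -⟩ := PhysL2.exists_groundState (L := L) β
    have hW' := hW β hβ₁ L hL₁ hcase Ω hΩ hn heig
    have hP' := hP β hβpos L Ω hΩ hn heig
    dsimp only at hW' hP'
    obtain ⟨hD2, hNpos⟩ := hW'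
    obtain ⟨hψ, horth⟩ := hP'
    have hdom := Deficit.l2_iterate_le_of_orth_ground hβpos hΩ hψ hn heig horth (m := 1) le_rfl
    simp only [pow_one, Function.iterate_one] at hdom
    rw [levelValue_zero, levelValue_one]
    refine (mul_le_mul_of_nonneg_right hk1 (pow_nonneg hT0.le L)).trans ?_
    exact current_endgame hLone hT0 hNpos hβ2 hdom hD2
  · -- ### the tail
    have hge : β ^ a ≤ (L : ℝ) := (not_le.mp hcase).le
    have h := hT β hβ₃ L hL₃ hge hLA
    calc β ^ (-(max k₃ 1)) * levelValue su2Rep L β 0 ^ L ≤ β ^ (-k₃) * levelValue su2Rep L β 0 ^ L :=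
          mul_le_mul_of_nonneg_right hk3 hpow0
      _ ≤ levelValue su2Rep L β 1 ^ L := h

end Summit.QuantumFields.YangMills.Theorems.CovariantCurrentDoor

end
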